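import Literature.Probability.Percolation.TriBallDisc
import HarnessLib

/-!
# Two open crossings in distinct open clusters of an annulus come with two closed crossings in between

Topic `Literature/Probability/Percolation`; family `crit-perc` / near-critical percolation on `𝕋`.
The planar input of the arm-separation theorem for four arms of ALTERNATING colours (Nolin 2008,
Thm. 11 [arXiv 0711.4948: Thm. 10], `j = 4`, `σ = BWBW`): Nolin's arms are curves "in
counterclockwise order" (§4.1), whereas the tree's alternating event `altFourArm` (`AltFourArm.lean`)
is in CLUSTER form (two open arms not joined by an open path of the annulus, two closed ones not by
a closed path). A witness family of the cluster form may sit around the annulus in the adjacent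
order `B B W W` (the planar configuration being then `B W' B W B' W`), which no disjoint system of
landing corridors can carry to alternating landing areas. This file extracts, from the two OPEN
arms alone, a canonical alternating family whose cyclic order on the outer boundary is CERTIFIED in
terms of the perimeter coordinate `hexPos` of `TriBallDisc.lean`:

Let `A = {n ≤ |·| ≤ N}` (`triAnn n N`, `1 ≤ n`, `n + 2 ≤ N`), `B₁ : s₁ ⇝ t₁` and `B₂ : s₂ ⇝ t₂` open
paths of `A` from `∂Λ_n` to `∂Λ_N`, not joined by an open path of `A`. Let `Cl` be the open cluster
of `s₁` in `A` and `U` the component of `s₂` in `A ∖ Cl`.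

* `annCluster`, `annComp` — `Cl` and `U` as sets; closure and support lemmas; `U`-sites adjacent
  to `Cl` are closed (`not_mem_of_adj_cluster`).
* `annCompFin` — `U` as a `Finset`; **`isTriDisc_comp`**: `U` is a disc (connected by construction;
  its complement — hole, outside, `Cl`, other components — is connected), so its boundary darts
  form ONE anticlockwise cycle (`TriDiscShelling.lean`), based at a dart from `s₂` into the hole.
* Dart types by the head: into the hole (`|head| < n`), to the outside (`|head| > N`), or into
  `Cl` (`head_mem_cluster_of_mem_ann`); hole- and outside-darts are never consecutive; at a change
  of type the tail is kept (`fst_eq_of_type_ne`).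
* **`exists_frontier_chains`** — scanning the cycle from the base (hole) to an outside-dart at `t₂`
  and on to the next hole-dart: the two maximal runs of `Cl`-darts adjacent to these hole/outside
  stretches have CLOSED tails, all adjacent to `Cl`, forming two `𝕋`-paths of closed sites of `U`,
  `d₁ : σ₁ ⇝ τ₁` and `d₂ : τ₂ ⇝ σ₂`, with `|σᵢ| = n`, `|τᵢ| = N` — two closed crossings of `A`
  ("the annFrontier of the cluster of `B₁` facing `B₂`", Kesten 1982, §2.3, made combinatorial by the
  boundary traversal) — together with the transition darts: the `Cl`-site `c₁` seen just before
  `τ₁` is the CLOCKWISE perimeter-neighbour of `τ₁`, the `Cl`-site `c₂` seen just after `τ₂` is the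
  ANTICLOCKWISE perimeter-neighbour of `τ₂` (via the hexagon's own traversal,
  `hexPos_fst_triBdrySucc`, and the identity `R² - R + 1 = 0` for the rotation `R` by `60°`).
* **`hexShift`** and the ORDER THEOREM `annFrontier_order` — in the perimeter coordinate shifted to
  start at `τ₁`: `0 = τ₁ < t₂ < τ₂ < c` for EVERY site `c` of `Cl` on `∂Λ_N` (in particular `t₁`,
  and any other point where the cluster of `B₁` touches `∂Λ_N`), every `U`-site of `∂Λ_N` is
  `≤ τ₂`, by `triBall_not_interleaved` (`U`-paths against `Cl`-paths);
* **`annFrontier_not_joined`** — `d₁` and `d₂` are not joined by a closed path of `A` (cluster form of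
  the new family `(B₁, d₁, B₂, d₂)`), by `triBall_not_interleaved` once more (the closed path
  against `B₂ · hole · B₁`).

Everything here is proved; no named facts are introduced.

## References

* P. Nolin, *Near-critical percolation in two dimensions*, Electron. J. Probab. 13 (2008), §4.1,
  §4.4 (proof of Thm. 11) [arXiv 0711.4948: Thm. 10]. [Nolin2008]
* H. Kesten, *Percolation theory for mathematicians* (1982), §2.2–2.3 (boundaries of occupied
  clusters on the triangular lattice). [KestenPTM1982]
* B. Bollobás, O. Riordan, *Percolation*, CUP (2006), Ch. 7 §7.2.2, Lemma 5. [BollobasRiordan2006]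

Tree: `TriBallDisc.lean` (`hexPos`, `triBall_not_interleaved`, `hexPos_fst_triBdrySucc`,
`exists_pathIn_outward`, `pathIn_triSphere`, rotation lemmas), `IsTriDisc` API
(`TriDiscShelling.lean`), `exists_isTriDisc_of_coconnected` (`TriPolyhexDisc.lean`), `triAnn`
(`AltFourArm.lean`), `pathIn_triBall`, `exists_adj_mem_triBall_sub_one` (`LandedAltFourArm.lean`),
`PathIn` API (`SitePaths.lean`, `TriRSWChaining.lean`).
-/

noncomputable section

open Finset

namespace Literature.Probability.Percolation

open LatticeModels

/-! ### Paths inside their own reachable set -/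

/-- A path inside `X` from `a` runs inside the set of points reachable from `a` inside `X`. [folklore] -/
theorem PathIn.to_reach {X : Set (Site 2)} {a v : Site 2} (h : PathIn triGraph X a v) :
    PathIn triGraph {w : Site 2 | PathIn triGraph X a w} a v := by
  obtain ⟨S, hSX, hp, htight⟩ := h.exists_support
  exact hp.mono fun z hz => (htight z hz).mono hSX

/-! ### The open cluster of a site in the annulus, and the components of its complement -/

section Setting

variable (n N : ℕ) (ω : SiteConfig (Site 2)) (s₁ : Site 2)

/-- **The open cluster of `s₁` in the annulus `A = {n ≤ |·| ≤ N}`**: sites joined to `s₁` by an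
open `𝕋`-path of `A`. [cite: KestenPTM1982, §2.2] -/
def annCluster : Set (Site 2) := {v | PathIn triGraph (triAnn n N ∩ ω) s₁ v}

/-- **The component of `s₂` in the annulus minus the cluster**: sites joined to `s₂` by a
`𝕋`-path of `A ∖ Cl` (any colours). [cite: KestenPTM1982, §2.3] -/
def annComp (s₂ : Site 2) : Set (Site 2) := {v | PathIn triGraph (triAnn n N \ annCluster n N ω s₁) s₂ v}

end Setting

section API

variable {n N : ℕ} {ω : SiteConfig (Site 2)} {s₁ s₂ : Site 2}

/-- The cluster lies in the open sites of the annulus. [folklore] -/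
theorem annCluster_subset : annCluster n N ω s₁ ⊆ triAnn n N ∩ ω := fun _ hv => hv.right_mem

/-- The cluster is closed under open steps inside the annulus. [folklore] -/
theorem mem_annCluster_of_adj {v w : Site 2} (hv : v ∈ annCluster n N ω s₁) (hw : w ∈ triAnn n N ∩ ω)
    (hadj : triGraph.Adj v w) : w ∈ annCluster n N ω s₁ :=
  PathIn.tail hv hadj hw

/-- Two sites of the cluster are joined INSIDE the cluster. [folklore] -/
theorem pathIn_annCluster {v w : Site 2} (hv : v ∈ annCluster n N ω s₁) (hw : w ∈ annCluster n N ω s₁) :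
    PathIn triGraph (annCluster n N ω s₁) v w :=
  (PathIn.to_reach hv).symm.trans (PathIn.to_reach hw)

/-- The component lies in the annulus, off the cluster. [folklore] -/
theorem annComp_subset : annComp n N ω s₁ s₂ ⊆ triAnn n N \ annCluster n N ω s₁ := fun _ hv => hv.right_mem

/-- The component is closed under steps inside `A ∖ Cl`. [folklore] -/
theorem mem_annComp_of_adj {v w : Site 2} (hv : v ∈ annComp n N ω s₁ s₂) (hw : w ∈ triAnn n N \ annCluster n N ω s₁)
    (hadj : triGraph.Adj v w) : w ∈ annComp n N ω s₁ s₂ :=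
  PathIn.tail hv hadj hw

/-- Two sites of the component are joined INSIDE the component. [folklore] -/
theorem pathIn_annComp {v w : Site 2} (hv : v ∈ annComp n N ω s₁ s₂) (hw : w ∈ annComp n N ω s₁ s₂) :
    PathIn triGraph (annComp n N ω s₁ s₂) v w :=
  (PathIn.to_reach hv).symm.trans (PathIn.to_reach hw)

/-- **Sites of the component next to the cluster are closed** (an open one would belong to the
cluster). [cite: KestenPTM1982, §2.3] -/
theorem not_mem_of_adj_cluster {v c : Site 2} (hv : v ∈ annComp n N ω s₁ s₂) (hc : c ∈ annCluster n N ω s₁)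
    (hadj : triGraph.Adj v c) : v ∉ ω := by
  intro hvω
  have hvA := (annComp_subset hv).1
  exact (annComp_subset hv).2 (mem_annCluster_of_adj hc ⟨hvA, hvω⟩ hadj.symm)

/-- A site of the annulus adjacent to the component and off the cluster is in the component;
contrapositively, an annulus site outside the component adjacent to it lies in the cluster. [folklore] -/
theorem mem_cluster_of_adj_of_not_mem {v w : Site 2} (hv : v ∈ annComp n N ω s₁ s₂) (hw : w ∈ triAnn n N)
    (hwU : w ∉ annComp n N ω s₁ s₂) (hadj : triGraph.Adj v w) : w ∈ annCluster n N ω s₁ := by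
  by_contra h
  exact hwU (mem_annComp_of_adj hv ⟨hw, h⟩ hadj)

/-! ### The component as a finite set; it is a disc -/

/-- The component as a `Finset` (it lies in `Λ_N`). [folklore] -/
def annCompFin (n N : ℕ) (ω : SiteConfig (Site 2)) (s₁ s₂ : Site 2) : Finset (Site 2) := by
  classical exact (triBall N).filter fun v => v ∈ annComp n N ω s₁ s₂

/-- `↑(annCompFin) = annComp`. [folklore] -/
theorem coe_annCompFin : (↑(annCompFin n N ω s₁ s₂) : Set (Site 2)) = annComp n N ω s₁ s₂ := by
  classical
  ext v
  simp only [annCompFin, coe_filter, Set.mem_setOf_eq]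
  constructor
  · exact fun h => h.2
  · intro h
    exact ⟨mem_triBall_iff.2 ((mem_triAnn.1 (annComp_subset h).1).2), h⟩

/-- Membership in `annCompFin`. [folklore] -/
theorem mem_annCompFin {v : Site 2} : v ∈ annCompFin n N ω s₁ s₂ ↔ v ∈ annComp n N ω s₁ s₂ := by
  rw [← Finset.mem_coe, coe_annCompFin]

/-- **Escaping from a site of the annulus off the component and off the cluster**: going radially
outward one reaches, without entering the component, either the cluster or the outside of `Λ_N`
(the first site met outside `A ∖ Cl ∖ U` cannot be in `U`, which is closed under steps in `A ∖ Cl`). [folklore] -/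
theorem exists_escape {o : Site 2} (hoA : o ∈ triAnn n N) (hoU : o ∉ annComp n N ω s₁ s₂)
    (hoCl : o ∉ annCluster n N ω s₁) :
    ∃ b : Site 2, (b ∈ annCluster n N ω s₁ ∨ (N : ℤ) < triNorm b) ∧ PathIn triGraph (annComp n N ω s₁ s₂)ᶜ o b := by
  have hoN := (mem_triAnn.1 hoA).2
  obtain ⟨w, hw, hp⟩ := exists_pathIn_outward o (N + 1) (by push_cast; omega)
  set R : Set (Site 2) := {z | z ∉ annComp n N ω s₁ s₂ ∧ z ∉ annCluster n N ω s₁ ∧ triNorm z ≤ N} with hR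
  have hwR : w ∉ R := fun h => by have := h.2.2; rw [hw] at this; push_cast at this; omega
  obtain ⟨a, b, haR, hbR, hbS, hab, hpa⟩ := hp.exit (R := R) ⟨hoU, hoCl, hoN⟩ hwR
  have hpa' : PathIn triGraph (annComp n N ω s₁ s₂)ᶜ o a := hpa.mono fun z hz => hz.1.1
  have haA : a ∈ triAnn n N := mem_triAnn.2 ⟨le_trans (mem_triAnn.1 hoA).1 hpa.right_mem.2, haR.2.2⟩
  have hbR' : b ∈ annComp n N ω s₁ s₂ ∨ b ∈ annCluster n N ω s₁ ∨ (N : ℤ) < triNorm b := by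
    by_contra h
    push Not at h
    exact hbR ⟨h.1, h.2.1, h.2.2⟩
  rcases hbR' with hbU | hbCl | hbN
  · exact absurd (mem_annComp_of_adj hbU ⟨haA, haR.2.1⟩ hab.symm) haR.1
  · exact ⟨b, Or.inl hbCl, hpa'.tail hab fun hbU => (annComp_subset hbU).2 hbCl⟩
  · exact ⟨b, Or.inr hbN, hpa'.tail hab fun hbU => by
      have := (mem_triAnn.1 (annComp_subset hbU).1).2; omega⟩

/-- **The complement of the component is connected** (`1 ≤ n ≤ N`, `s₁` open of norm `n`, and the
cluster of `s₁` reaches `∂Λ_N` at `t₁`): hole, cluster and outside are joined to one another off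
the component (the cluster touches both), every other site off the component escapes to one of
them (`exists_escape`), and the outside is connected (`pathIn_triSphere`). [folklore] -/
theorem annComp_coconnected (hn : 1 ≤ n) (hnN : n ≤ N) (hs₁ : triNorm s₁ = n) (hs₁ω : s₁ ∈ ω)
    {t₁ : Site 2} (ht₁ : t₁ ∈ annCluster n N ω s₁) (ht₁N : triNorm t₁ = N) :
    ∀ o ∉ annCompFin n N ω s₁ s₂, ∀ o' ∉ annCompFin n N ω s₁ s₂,
      PathIn triGraph ((↑(annCompFin n N ω s₁ s₂) : Set (Site 2))ᶜ) o o' := by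
  set U := annComp n N ω s₁ s₂ with hU
  set Cl := annCluster n N ω s₁ with hCl
  have hcoe : ((↑(annCompFin n N ω s₁ s₂) : Set (Site 2))ᶜ) = Uᶜ := by rw [coe_annCompFin]
  rw [hcoe]
  have hUA : ∀ v ∈ U, v ∈ triAnn n N := fun v hv => (annComp_subset hv).1
  have outU : ∀ v : Site 2, (N : ℤ) < triNorm v → v ∈ Uᶜ := fun v hv hvU => by
    have := (mem_triAnn.1 (hUA v hvU)).2; omega
  have holeU : ∀ v : Site 2, triNorm v < n → v ∈ Uᶜ := fun v hv hvU => by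
    have := (mem_triAnn.1 (hUA v hvU)).1; omega
  have clU : ∀ v ∈ Cl, v ∈ Uᶜ := fun v hv hvU => (annComp_subset hvU).2 hv
  have hs₁Cl : s₁ ∈ Cl := PathIn.refl ⟨mem_triAnn.2 ⟨hs₁.ge, by omega⟩, hs₁ω⟩
  -- the cluster is joined off `U` to the outside
  have clOut : ∀ c ∈ Cl, ∃ w : Site 2, (N : ℤ) < triNorm w ∧ PathIn triGraph Uᶜ c w := by
    intro c hc
    obtain ⟨w, hadj, hw⟩ := exists_adj_triNorm_eq_add_one t₁
    exact ⟨w, by omega, ((pathIn_annCluster hc ht₁).mono fun v hv => clU v hv).tail hadj (outU w (by omega))⟩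
  -- every site off `U` is joined off `U` to the outside
  have toOut : ∀ o ∈ Uᶜ, ∃ w : Site 2, (N : ℤ) < triNorm w ∧ PathIn triGraph Uᶜ o w := by
    intro o ho
    by_cases hoN : (N : ℤ) < triNorm o
    · exact ⟨o, hoN, PathIn.refl ho⟩
    by_cases hon : triNorm o < n
    · -- through the hole to `s₁`, then through the cluster
      obtain ⟨h₁, hadj₁, hh₁⟩ := exists_adj_mem_triBall_sub_one hn hs₁
      have hh₁' : triNorm h₁ < n := by omega
      have p1 : PathIn triGraph Uᶜ o h₁ :=
        (pathIn_triBall (m := n - 1) (by omega) hh₁).mono fun v hv => holeU v (by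
          have := mem_triBall_iff.1 (Finset.mem_coe.1 hv); omega)
      have p2 : PathIn triGraph Uᶜ h₁ s₁ := PathIn.of_adj (holeU h₁ hh₁') (clU s₁ hs₁Cl) hadj₁.symm
      obtain ⟨w, hw, p3⟩ := clOut s₁ hs₁Cl
      exact ⟨w, hw, (p1.trans p2).trans p3⟩
    · push Not at hoN hon
      by_cases hoCl : o ∈ Cl
      · exact clOut o hoCl
      · obtain ⟨b, hb, hp⟩ := exists_escape (mem_triAnn.2 ⟨hon, hoN⟩) ho hoCl
        rcases hb with hbCl | hbN
        · obtain ⟨w, hw, p3⟩ := clOut b hbCl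
          exact ⟨w, hw, hp.trans p3⟩
        · exact ⟨b, hbN, hp⟩
  -- the outside is connected off `U`
  have outConn : ∀ w w' : Site 2, (N : ℤ) < triNorm w → (N : ℤ) < triNorm w' → PathIn triGraph Uᶜ w w' := by
    intro w w' hw hw'
    have h0 := triNorm_nonneg w
    have h0' := triNorm_nonneg w'
    set K : ℕ := (triNorm w + triNorm w').toNat with hK
    obtain ⟨z, hz, hp⟩ := exists_pathIn_outward w K (by omega)
    obtain ⟨z', hz', hp'⟩ := exists_pathIn_outward w' K (by omega)
    have hs := pathIn_triSphere (K := K) (by omega) hz hz'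
    refine ((hp.mono fun v hv => outU v (lt_of_lt_of_le hw hv)).trans
      (hs.mono fun v hv => outU v ?_)).trans (hp'.mono fun v hv => outU v (lt_of_lt_of_le hw' hv)).symm
    have hv' : triNorm v = K := hv
    omega
  intro o ho o' ho'
  rw [mem_annCompFin] at ho ho'
  obtain ⟨w, hw, hp⟩ := toOut o ho
  obtain ⟨w', hw', hp'⟩ := toOut o' ho'
  exact (hp.trans (outConn w w' hw hw')).trans hp'.symm

/-- **The component is a disc** (`exists_isTriDisc_of_coconnected`), provided it is nonempty. [cite: BollobasRiordan2006, Ch. 7 §7.2.2 p. 168] -/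
theorem exists_isTriDisc_annComp (hn : 1 ≤ n) (hnN : n ≤ N) (hs₁ : triNorm s₁ = n) (hs₁ω : s₁ ∈ ω)
    {t₁ : Site 2} (ht₁ : t₁ ∈ annCluster n N ω s₁) (ht₁N : triNorm t₁ = N)
    (hs₂ : s₂ ∈ annComp n N ω s₁ s₂) : ∃ b, IsTriDisc (annCompFin n N ω s₁ s₂) b := by
  refine exists_isTriDisc_of_coconnected _ _ rfl ⟨s₂, mem_annCompFin.2 hs₂⟩ ?_ (annComp_coconnected hn hnN hs₁ hs₁ω ht₁ ht₁N)
  intro p hp q hq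
  rw [coe_annCompFin]
  exact pathIn_annComp (mem_annCompFin.1 hp) (mem_annCompFin.1 hq)

/-! ### Boundary darts of the component: three types by the head -/

/-- **The head of a boundary dart of the component lies in the hole, outside `Λ_N`, or in the
cluster**: an annulus site off the component but adjacent to it is in the cluster. [folklore] -/
theorem head_cases {d : Site 2 × Site 2} (hd : d ∈ triBdryDarts (annCompFin n N ω s₁ s₂)) :
    triNorm d.2 < n ∨ (N : ℤ) < triNorm d.2 ∨ d.2 ∈ annCluster n N ω s₁ := by
  obtain ⟨h1, h2, hadj⟩ := mem_triBdryDarts.1 hd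
  rw [mem_annCompFin] at h1 h2
  by_cases hA : d.2 ∈ triAnn n N
  · exact Or.inr (Or.inr (mem_cluster_of_adj_of_not_mem h1 hA h2 hadj))
  · rw [mem_triAnn, not_and_or, not_le, not_le] at hA
    rcases hA with h | h
    · exact Or.inl h
    · exact Or.inr (Or.inl h)

/-- The tail of a hole-dart has norm `n`, and its head norm `n - 1`. [folklore] -/
theorem norm_of_hole_dart {d : Site 2 × Site 2} (hd : d ∈ triBdryDarts (annCompFin n N ω s₁ s₂)) (h : triNorm d.2 < n) :
    triNorm d.1 = n := by
  obtain ⟨h1, -, hadj⟩ := mem_triBdryDarts.1 hd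
  have := (mem_triAnn.1 (annComp_subset (mem_annCompFin.1 h1)).1).1
  have := triNorm_le_triNorm_add_one_of_adj' hadj
  omega

/-- The tail of an outside-dart has norm `N`. [folklore] -/
theorem norm_of_out_dart {d : Site 2 × Site 2} (hd : d ∈ triBdryDarts (annCompFin n N ω s₁ s₂)) (h : (N : ℤ) < triNorm d.2) :
    triNorm d.1 = N := by
  obtain ⟨h1, -, hadj⟩ := mem_triBdryDarts.1 hd
  have := (mem_triAnn.1 (annComp_subset (mem_annCompFin.1 h1)).1).2
  have := triNorm_le_triNorm_add_one_of_adj hadj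
  omega

/-- **The tail of a cluster-dart is a CLOSED site of the component adjacent to the cluster.** [cite: KestenPTM1982, §2.3] -/
theorem tail_of_cluster_dart {d : Site 2 × Site 2} (hd : d ∈ triBdryDarts (annCompFin n N ω s₁ s₂))
    (h : d.2 ∈ annCluster n N ω s₁) :
    d.1 ∈ annComp n N ω s₁ s₂ ∧ d.1 ∉ ω ∧ triGraph.Adj d.1 d.2 := by
  obtain ⟨h1, -, hadj⟩ := mem_triBdryDarts.1 hd
  rw [mem_annCompFin] at h1
  exact ⟨h1, not_mem_of_adj_cluster h1 h hadj, hadj⟩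

/-- A hole-dart and an outside-dart are never consecutive (`n + 2 ≤ N`): their tails have norms
`n` and `N`, neither equal nor adjacent. [folklore] -/
theorem not_hole_then_out (hnN : n + 2 ≤ N) {d : Site 2 × Site 2} (hd : d ∈ triBdryDarts (annCompFin n N ω s₁ s₂)) :
    ¬ ((triNorm d.2 < n ∧ (N : ℤ) < triNorm (triBdrySucc (annCompFin n N ω s₁ s₂) d).2) ∨
       ((N : ℤ) < triNorm d.2 ∧ triNorm (triBdrySucc (annCompFin n N ω s₁ s₂) d).2 < n)) := by
  have hd' := triBdrySucc_mem hd
  obtain ⟨-, -, hadj⟩ := mem_triBdryDarts.1 hd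
  -- tails of consecutive darts are equal or adjacent
  have htails : (triBdrySucc (annCompFin n N ω s₁ s₂) d).1 = d.1 ∨
      triGraph.Adj d.1 (triBdrySucc (annCompFin n N ω s₁ s₂) d).1 := by
    unfold triBdrySucc
    split_ifs
    · exact Or.inr (triGraph_adj_triLeftApex_left hadj)
    · exact Or.inl rfl
  rintro (⟨h1, h2⟩ | ⟨h1, h2⟩)
  · have e1 := norm_of_hole_dart hd h1
    have e2 := norm_of_out_dart hd' h2
    rcases htails with e | hadj'
    · rw [e] at e2; omega
    · have := triNorm_le_triNorm_add_one_of_adj hadj'; omega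
  · have e1 := norm_of_out_dart hd h1
    have e2 := norm_of_hole_dart hd' h2
    rcases htails with e | hadj'
    · rw [e] at e2; omega
    · have := triNorm_le_triNorm_add_one_of_adj' hadj'; omega

/-- **At a change of type the tail is kept**: if the successor of a boundary dart does not have the
same head, it has the same tail. [folklore] -/
theorem fst_succ_eq_or_snd_succ_eq (G : Finset (Site 2)) (d : Site 2 × Site 2) :
    (triBdrySucc G d).1 = d.1 ∨ (triBdrySucc G d).2 = d.2 := by
  unfold triBdrySucc
  split_ifs
  · exact Or.inr rfl
  · exact Or.inl rfl

/-- Tails of consecutive boundary darts are equal or adjacent. [folklore] -/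
theorem fst_triBdrySucc_eq_or_adj (G : Finset (Site 2)) {d : Site 2 × Site 2} (hd : triGraph.Adj d.1 d.2) :
    (triBdrySucc G d).1 = d.1 ∨ triGraph.Adj d.1 (triBdrySucc G d).1 := by
  unfold triBdrySucc
  split_ifs
  · exact Or.inr (triGraph_adj_triLeftApex_left hd)
  · exact Or.inl rfl

/-- The triBdrySucc either keeps the tail and turns the head to the left apex, or keeps the head
and moves the tail to the left apex. [folklore] -/
theorem triBdrySucc_eq_or (G : Finset (Site 2)) (d : Site 2 × Site 2) :
    triBdrySucc G d = (d.1, triLeftApex d.1 d.2) ∨ triBdrySucc G d = (triLeftApex d.1 d.2, d.2) := by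
  unfold triBdrySucc
  split_ifs
  · exact Or.inr rfl
  · exact Or.inl rfl

/-- **The annFrontier of the cluster inside the component**: closed sites of `U` adjacent to `Cl`. [cite: KestenPTM1982, §2.3] -/
def annFrontier (n N : ℕ) (ω : SiteConfig (Site 2)) (s₁ s₂ : Site 2) : Set (Site 2) :=
  {v | v ∈ annComp n N ω s₁ s₂ ∧ v ∉ ω ∧ ∃ c ∈ annCluster n N ω s₁, triGraph.Adj v c}

/-- The annFrontier consists of closed sites of the annulus. [folklore] -/
theorem annFrontier_subset : annFrontier n N ω s₁ s₂ ⊆ triAnn n N \ ω := fun _ hv => ⟨(annComp_subset hv.1).1, hv.2.1⟩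

/-- The annFrontier lies in the component. [folklore] -/
theorem annFrontier_subset_annComp : annFrontier n N ω s₁ s₂ ⊆ annComp n N ω s₁ s₂ := fun _ hv => hv.1

/-- The tail of a cluster-dart of the component is a annFrontier site. [folklore] -/
theorem fst_mem_annFrontier {d : Site 2 × Site 2} (hd : d ∈ triBdryDarts (annCompFin n N ω s₁ s₂))
    (h : d.2 ∈ annCluster n N ω s₁) : d.1 ∈ annFrontier n N ω s₁ s₂ := by
  obtain ⟨h1, h2, h3⟩ := tail_of_cluster_dart hd h
  exact ⟨h1, h2, d.2, h, h3⟩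

/-! ### The two annFrontier chains -/

/-- **The data of the two annFrontier chains** of the cluster `Cl` of `s₁` inside the component `U`
of `s₂` (Kesten's "boundary of the occupied cluster", read off the boundary cycle of the disc `U`):
two `𝕋`-paths of annFrontier sites (closed, in `U`, adjacent to `Cl`), `σ₁ ⇝ τ₁` and `τ₂ ⇝ σ₂`, from
`∂Λ_n` to `∂Λ_N`, together with the transition data at the outer ends: the cluster site `c₁`
(adjacent to `τ₁`, its CLOCKWISE perimeter neighbour: the left apex of `τ₁ → c₁` is outside `Λ_N`)
and the cluster site `c₂` (the left apex of `τ₂ → o₂` for an outer neighbour `o₂` of `τ₂`, hence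
the ANTICLOCKWISE perimeter neighbour of `τ₂`). [cite: KestenPTM1982, §2.3] -/
structure FrontierChains (n N : ℕ) (ω : SiteConfig (Site 2)) (s₁ s₂ : Site 2) where
  /-- inner end of the first chain -/
  σ₁ : Site 2
  /-- outer end of the first chain -/
  τ₁ : Site 2
  /-- the cluster site seen just before `τ₁` -/
  c₁ : Site 2
  /-- outer end of the second chain -/
  τ₂ : Site 2
  /-- inner end of the second chain -/
  σ₂ : Site 2
  /-- an outer neighbour of `τ₂` -/
  o₂ : Site 2
  chain₁ : PathIn triGraph (annFrontier n N ω s₁ s₂) σ₁ τ₁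
  chain₂ : PathIn triGraph (annFrontier n N ω s₁ s₂) τ₂ σ₂
  norm_σ₁ : triNorm σ₁ = n
  norm_τ₁ : triNorm τ₁ = N
  norm_τ₂ : triNorm τ₂ = N
  norm_σ₂ : triNorm σ₂ = n
  c₁_mem : c₁ ∈ annCluster n N ω s₁
  adj₁ : triGraph.Adj τ₁ c₁
  apex₁_out : (N : ℤ) < triNorm (triLeftApex τ₁ c₁)
  o₂_out : (N : ℤ) < triNorm o₂
  adj₂ : triGraph.Adj τ₂ o₂
  apex₂_mem : triLeftApex τ₂ o₂ ∈ annCluster n N ω s₁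

/-- **Existence of the annFrontier chains.** For `1 ≤ n`, `n + 2 ≤ N`, an open path `B₁ : s₁ ⇝ t₁`
of the annulus `A = {n ≤ |·| ≤ N}` with `|s₁| = n`, `|t₁| = N`, and a site `s₂` of `A ∖ Cl`
(`Cl` the open cluster of `s₁` in `A`) of norm `n` whose component `U` in `A ∖ Cl` contains a site
`t₂` of norm `N`: the annFrontier chains exist. Proof: `U` is a disc (`exists_isTriDisc_annComp`); traverse
its boundary from the dart `s₂ →` hole; let `p_t` carry the dart `t₂ →` outside; the last hole-dart
`p_h ≤ p_t` is followed by cluster-darts up to the first outside-dart `p_r` (hole- and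
outside-darts are never consecutive), whose tails — kept at both type changes — form the first
chain; symmetrically after `p_t`, the last outside-dart `p_r'` before the next hole-dart `p_h'`
starts the second chain. The transition data are read off `triBdrySucc`. [cite: KestenPTM1982, §2.3] -/
theorem nonempty_frontierChains (hn : 1 ≤ n) (hnN : n + 2 ≤ N) (hs₁ : triNorm s₁ = n) (hs₁ω : s₁ ∈ ω)
    {t₁ : Site 2} (ht₁ : t₁ ∈ annCluster n N ω s₁) (ht₁N : triNorm t₁ = N)
    (hs₂ : s₂ ∈ annComp n N ω s₁ s₂) (hs₂n : triNorm s₂ = n)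
    {t₂ : Site 2} (ht₂ : t₂ ∈ annComp n N ω s₁ s₂) (ht₂N : triNorm t₂ = N) :
    Nonempty (FrontierChains n N ω s₁ s₂) := by
  classical
  set G := annCompFin n N ω s₁ s₂ with hG
  set Cl := annCluster n N ω s₁ with hCl
  -- the disc and its base dart `s₂ → hole`
  obtain ⟨b, hb⟩ := exists_isTriDisc_annComp hn (by omega) hs₁ hs₁ω ht₁ ht₁N hs₂
  obtain ⟨h₂, hadj₂, hh₂⟩ := exists_adj_mem_triBall_sub_one hn hs₂n
  have hh₂' : triNorm h₂ < n := by
    have := hh₂; push_cast [Nat.cast_sub hn] at this; omega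
  have hh₂G : h₂ ∉ G := fun h' => by
    have := (mem_triAnn.1 (annComp_subset (mem_annCompFin.1 h')).1).1; omega
  have hds : (s₂, h₂) ∈ triBdryDarts G := mem_triBdryDarts.2 ⟨mem_annCompFin.2 hs₂, hh₂G, hadj₂⟩
  have h := hb.rebase hds
  set P := #(triBdryDarts G) with hP
  set it : ℕ → Site 2 × Site 2 := fun k => triBdryIter G (s₂, h₂) k with hit
  have it_mem : ∀ k, it k ∈ triBdryDarts G := fun k => triBdryIter_mem hds k
  have it_succ : ∀ k, it (k + 1) = triBdrySucc G (it k) := fun k => triBdryIter_succ G _ k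
  -- types
  set Hole : ℕ → Prop := fun k => triNorm (it k).2 < n with hHole
  set Out : ℕ → Prop := fun k => (N : ℤ) < triNorm (it k).2 with hOut
  set ClD : ℕ → Prop := fun k => (it k).2 ∈ Cl with hClD
  have cases3 : ∀ k, Hole k ∨ Out k ∨ ClD k := fun k => head_cases (it_mem k)
  have Cl_norm : ∀ v ∈ Cl, (n : ℤ) ≤ triNorm v ∧ triNorm v ≤ N := fun v hv =>
    mem_triAnn.1 (annCluster_subset hv).1
  have hole_not_out : ∀ k, Hole k → ¬ Out k := fun k h1 h2 => by
    simp only [hHole, hOut] at h1 h2; omega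
  have hole_not_cl : ∀ k, Hole k → ¬ ClD k := fun k h1 h2 => by
    have := (Cl_norm _ h2).1; simp only [hHole] at h1; omega
  have out_not_cl : ∀ k, Out k → ¬ ClD k := fun k h1 h2 => by
    have := (Cl_norm _ h2).2; simp only [hOut] at h1; omega
  have clD_of : ∀ k, ¬ Hole k → ¬ Out k → ClD k := fun k h1 h2 => by
    rcases cases3 k with h | h | h
    · exact absurd h h1
    · exact absurd h h2
    · exact h
  -- no hole/outside consecutive
  have no_HO : ∀ k, ¬ (Hole k ∧ Out (k + 1)) := fun k hk => by
    have := not_hole_then_out hnN (it_mem k)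
    rw [← it_succ] at this
    exact this (Or.inl hk)
  have no_OH : ∀ k, ¬ (Out k ∧ Hole (k + 1)) := fun k hk => by
    have := not_hole_then_out hnN (it_mem k)
    rw [← it_succ] at this
    exact this (Or.inr hk)
  -- at a type change the tail is kept: if the head is kept the type is kept
  have head_kept_or_tail_kept : ∀ k, (it (k + 1)).1 = (it k).1 ∨ (it (k + 1)).2 = (it k).2 := fun k => by
    rw [it_succ]; exact fst_succ_eq_or_snd_succ_eq G (it k)
  -- the hole-dart at position `0` and `P`
  have Hole0 : Hole 0 := by show triNorm (triBdryIter G (s₂, h₂) 0).2 < n; rw [triBdryIter_zero]; exact hh₂'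
  have HoleP : Hole P := by show triNorm (triBdryIter G (s₂, h₂) P).2 < n; rw [h.cycle_len]; exact hh₂'
  -- the outside-dart at `t₂`
  obtain ⟨o, hadjo, ho⟩ := exists_adj_triNorm_eq_add_one t₂
  have hoG : o ∉ G := fun h' => by
    have := (mem_triAnn.1 (annComp_subset (mem_annCompFin.1 h')).1).2; omega
  have hdt : (t₂, o) ∈ triBdryDarts G := mem_triBdryDarts.2 ⟨mem_annCompFin.2 ht₂, hoG, hadjo⟩
  obtain ⟨pt, hpt, hptd⟩ := h.cycle _ hdt
  have Out_pt : Out pt := by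
    show (N : ℤ) < triNorm (triBdryIter G (s₂, h₂) pt).2; rw [hptd]; show (N : ℤ) < triNorm o; omega
  ----------------------------------------------------------------
  -- FIRST CHAIN: `p_h` = last hole-dart `≤ pt`, `p_r` = first outside-dart after `p_h`
  ----------------------------------------------------------------
  set ph := Nat.findGreatest Hole pt with hph
  have Hole_ph : Hole ph := Nat.findGreatest_spec (P := Hole) (Nat.zero_le pt) Hole0
  have ph_le : ph ≤ pt := Nat.findGreatest_le pt
  have ph_max : ∀ k, ph < k → k ≤ pt → ¬ Hole k := fun k hk hk' => Nat.findGreatest_is_greatest hk hk'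
  have ph_lt : ph < pt := lt_of_le_of_ne ph_le fun e => hole_not_out _ Hole_ph (e ▸ Out_pt)
  have hex_r : ∃ k, ph < k ∧ Out k := ⟨pt, ph_lt, Out_pt⟩
  set pr := Nat.find hex_r with hpr
  obtain ⟨ph_lt_pr, Out_pr⟩ := Nat.find_spec hex_r
  have pr_min : ∀ k, ph < k → k < pr → ¬ Out k := fun k hk hk' hO => Nat.find_min hex_r hk' ⟨hk, hO⟩
  have pr_le : pr ≤ pt := Nat.find_min' hex_r ⟨ph_lt, Out_pt⟩
  have run1 : ∀ k, ph < k → k < pr → ClD k := fun k hk hk' =>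
    clD_of k (ph_max k hk (by omega)) (pr_min k hk hk')
  have ph1_lt_pr : ph + 1 < pr := by
    rcases Nat.lt_or_ge (ph + 1) pr with hlt | hge
    · exact hlt
    · exfalso
      have : pr = ph + 1 := by omega
      exact no_HO ph ⟨Hole_ph, this ▸ Out_pr⟩
  -- tails at the two ends
  have tail_ph1 : (it (ph + 1)).1 = (it ph).1 := by
    rcases head_kept_or_tail_kept ph with e | e
    · exact e
    · exfalso
      have : Hole (ph + 1) := by show triNorm (it (ph + 1)).2 < n; rw [e]; exact Hole_ph
      exact ph_max (ph + 1) (by omega) (by omega) this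
  have tail_pr : (it pr).1 = (it (pr - 1)).1 := by
    have e0 : pr - 1 + 1 = pr := by omega
    rcases head_kept_or_tail_kept (pr - 1) with e | e
    · rw [e0] at e; exact e
    · exfalso
      rw [e0] at e
      have : Out (pr - 1) := by show (N : ℤ) < triNorm (it (pr - 1)).2; rw [← e]; exact Out_pr
      exact pr_min (pr - 1) (by omega) (by omega) this
  -- the chain
  have chain1 : ∀ k, ph + 1 ≤ k → k < pr → PathIn triGraph (annFrontier n N ω s₁ s₂) (it (ph + 1)).1 (it k).1 := by
    intro k hk hk'
    induction k, hk using Nat.le_induction with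
    | base => exact PathIn.refl (fst_mem_annFrontier (it_mem _) (run1 _ (by omega) hk'))
    | succ k hk ih =>
      have ih' := ih (by omega)
      have hmem : (it (k + 1)).1 ∈ annFrontier n N ω s₁ s₂ := fst_mem_annFrontier (it_mem _) (run1 _ (by omega) hk')
      rcases fst_triBdrySucc_eq_or_adj G (mem_triBdryDarts.1 (it_mem k)).2.2 with e | hadj
      · rw [← it_succ] at e; rw [e] at hmem ⊢; exact ih'
      · rw [← it_succ] at hadj; exact ih'.tail hadj hmem
  -- transition data at `pr`: `it pr = (τ₁, apex)` with `it (pr-1) = (τ₁, c₁)`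
  have trans1 : it pr = ((it (pr - 1)).1, triLeftApex (it (pr - 1)).1 (it (pr - 1)).2) := by
    have e0 : pr - 1 + 1 = pr := by omega
    have hsucc : it pr = triBdrySucc G (it (pr - 1)) := by rw [← it_succ, e0]
    rcases triBdrySucc_eq_or G (it (pr - 1)) with e | e
    · rw [hsucc, e]
    · exfalso
      have hh : (it pr).2 = (it (pr - 1)).2 := by rw [hsucc, e]
      have : Out (pr - 1) := by show (N : ℤ) < triNorm (it (pr - 1)).2; rw [← hh]; exact Out_pr
      exact pr_min (pr - 1) (by omega) (by omega) this
  ----------------------------------------------------------------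
  -- SECOND CHAIN: `ph'` = first hole-dart after `pt`, `pr'` = last outside-dart before `ph'`
  ----------------------------------------------------------------
  have hex_h : ∃ k, pt < k ∧ Hole k := ⟨P, hpt, HoleP⟩
  set ph' := Nat.find hex_h with hph'
  obtain ⟨pt_lt_ph', Hole_ph'⟩ := Nat.find_spec hex_h
  have ph'_min : ∀ k, pt < k → k < ph' → ¬ Hole k := fun k hk hk' hH => Nat.find_min hex_h hk' ⟨hk, hH⟩
  set pr' := Nat.findGreatest Out (ph' - 1) with hpr'
  have Out_pr' : Out pr' := Nat.findGreatest_spec (P := Out) (show pt ≤ ph' - 1 by omega) Out_pt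
  have pr'_le : pr' ≤ ph' - 1 := Nat.findGreatest_le (ph' - 1)
  have pt_le_pr' : pt ≤ pr' := Nat.le_findGreatest (show pt ≤ ph' - 1 by omega) Out_pt
  have pr'_max : ∀ k, pr' < k → k ≤ ph' - 1 → ¬ Out k := fun k hk hk' => Nat.findGreatest_is_greatest hk hk'
  have run2 : ∀ k, pr' < k → k < ph' → ClD k := fun k hk hk' =>
    clD_of k (ph'_min k (by omega) hk') (pr'_max k hk (by omega))
  have pr'1_lt : pr' + 1 < ph' := by
    rcases Nat.lt_or_ge (pr' + 1) ph' with hlt | hge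
    · exact hlt
    · exfalso
      have : ph' = pr' + 1 := by omega
      exact no_OH pr' ⟨Out_pr', this ▸ Hole_ph'⟩
  have tail_pr'1 : (it (pr' + 1)).1 = (it pr').1 := by
    rcases head_kept_or_tail_kept pr' with e | e
    · exact e
    · exfalso
      have : Out (pr' + 1) := by show (N : ℤ) < triNorm (it (pr' + 1)).2; rw [e]; exact Out_pr'
      exact pr'_max (pr' + 1) (by omega) (by omega) this
  have tail_ph' : (it ph').1 = (it (ph' - 1)).1 := by
    have e0 : ph' - 1 + 1 = ph' := by omega
    rcases head_kept_or_tail_kept (ph' - 1) with e | e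
    · rw [e0] at e; exact e
    · exfalso
      rw [e0] at e
      have : Hole (ph' - 1) := by show triNorm (it (ph' - 1)).2 < n; rw [← e]; exact Hole_ph'
      exact ph'_min (ph' - 1) (by omega) (by omega) this
  have chain2 : ∀ k, pr' + 1 ≤ k → k < ph' → PathIn triGraph (annFrontier n N ω s₁ s₂) (it (pr' + 1)).1 (it k).1 := by
    intro k hk hk'
    induction k, hk using Nat.le_induction with
    | base => exact PathIn.refl (fst_mem_annFrontier (it_mem _) (run2 _ (by omega) hk'))
    | succ k hk ih =>
      have ih' := ih (by omega)
      have hmem : (it (k + 1)).1 ∈ annFrontier n N ω s₁ s₂ := fst_mem_annFrontier (it_mem _) (run2 _ (by omega) hk')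
      rcases fst_triBdrySucc_eq_or_adj G (mem_triBdryDarts.1 (it_mem k)).2.2 with e | hadj
      · rw [← it_succ] at e; rw [e] at hmem ⊢; exact ih'
      · rw [← it_succ] at hadj; exact ih'.tail hadj hmem
  -- transition data at `pr'`: `it (pr'+1) = (τ₂, apex (τ₂, o₂))`
  have trans2 : it (pr' + 1) = ((it pr').1, triLeftApex (it pr').1 (it pr').2) := by
    rcases triBdrySucc_eq_or G (it pr') with e | e
    · rw [it_succ, e]
    · exfalso
      have hh : (it (pr' + 1)).2 = (it pr').2 := by rw [it_succ, e]
      have : Out (pr' + 1) := by show (N : ℤ) < triNorm (it (pr' + 1)).2; rw [hh]; exact Out_pr'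
      exact pr'_max (pr' + 1) (by omega) (by omega) this
  ----------------------------------------------------------------
  -- assemble
  ----------------------------------------------------------------
  have ClD_pr1 : ClD (pr - 1) := run1 (pr - 1) (by omega) (by omega)
  have ClD_pr'1 : ClD (pr' + 1) := run2 (pr' + 1) (by omega) pr'1_lt
  obtain ⟨-, -, hadj_pr1⟩ := tail_of_cluster_dart (it_mem (pr - 1)) ClD_pr1
  obtain ⟨-, hout_pr', hadj_pr'⟩ := mem_triBdryDarts.1 (it_mem pr')
  refine ⟨{
    σ₁ := (it ph).1
    τ₁ := (it (pr - 1)).1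
    c₁ := (it (pr - 1)).2
    τ₂ := (it pr').1
    σ₂ := (it ph').1
    o₂ := (it pr').2
    chain₁ := ?_
    chain₂ := ?_
    norm_σ₁ := norm_of_hole_dart (it_mem ph) Hole_ph
    norm_τ₁ := ?_
    norm_τ₂ := norm_of_out_dart (it_mem pr') Out_pr'
    norm_σ₂ := norm_of_hole_dart (it_mem ph') Hole_ph'
    c₁_mem := ClD_pr1
    adj₁ := hadj_pr1
    apex₁_out := ?_
    o₂_out := Out_pr'
    adj₂ := hadj_pr'
    apex₂_mem := ?_ }⟩
  · -- chain₁
    have := chain1 (pr - 1) (by omega) (by omega)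
    rw [tail_ph1] at this
    exact this
  · -- chain₂
    have := chain2 (ph' - 1) (by omega) (by omega)
    rw [tail_pr'1, ← tail_ph'] at this
    exact this
  · -- norm of `τ₁`
    rw [← tail_pr]; exact norm_of_out_dart (it_mem pr) Out_pr
  · -- the apex of `τ₁ → c₁` is the head of the outside-dart `it pr`
    have : (it pr).2 = triLeftApex (it (pr - 1)).1 (it (pr - 1)).2 := by rw [trans1]
    rw [← this]; exact Out_pr
  · -- the apex of `τ₂ → o₂` is the head of the cluster-dart `it (pr'+1)`
    have : (it (pr' + 1)).2 = triLeftApex (it pr').1 (it pr').2 := by rw [trans2]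
    rw [← this]; exact ClD_pr'1

/-! ### Paths of `U` and of `Cl` as paths of the two classes `Λ_N ∩ U`, `Λ_N ∖ U` -/

/-- A path inside the component is a path of `Λ_N ∩ U`. [folklore] -/
theorem pathIn_ball_inter_annComp {u v : Site 2} (hu : u ∈ annComp n N ω s₁ s₂) (hv : v ∈ annComp n N ω s₁ s₂) :
    PathIn triGraph ((↑(triBall N) : Set (Site 2)) ∩ annComp n N ω s₁ s₂) u v :=
  (pathIn_annComp hu hv).mono fun _ hz =>
    ⟨Finset.mem_coe.2 (mem_triBall_iff.2 (mem_triAnn.1 (annComp_subset hz).1).2), hz⟩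

/-- A path inside the cluster is a path of `Λ_N ∖ U`. [folklore] -/
theorem pathIn_ball_diff_annComp {u v : Site 2} (hu : u ∈ annCluster n N ω s₁) (hv : v ∈ annCluster n N ω s₁) :
    PathIn triGraph ((↑(triBall N) : Set (Site 2)) ∩ (annComp n N ω s₁ s₂)ᶜ) u v :=
  (pathIn_annCluster hu hv).mono fun _ hz =>
    ⟨Finset.mem_coe.2 (mem_triBall_iff.2 (mem_triAnn.1 (annCluster_subset hz).1).2),
      fun hzU => (annComp_subset hzU).2 hz⟩

/-! ### The order theorem -/

/-- **The cyclic order of the cluster and of the component on `∂Λ_N`, read from `τ₁`.** Let `F` be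
annFrontier chains (`1 ≤ N`... `1 ≤ n`, `n + 2 ≤ N`). In the perimeter coordinate shifted to start at
`τ₁` (`hexShift N F.τ₁`):
(i) every site of the component `U` on `∂Λ_N` comes STRICTLY BEFORE every site of the cluster `Cl`
on `∂Λ_N`; (ii) every `U`-site of `∂Λ_N` is `≤ τ₂`; hence (iii) `τ₂ <` every cluster site of `∂Λ_N`,
and (iv) every OPEN `U`-site `t` of `∂Λ_N` (such as the tip of `B₂`) satisfies `0 < t < τ₂`. Proof:
`c₁` has shifted coordinate `6N - 1` (clockwise neighbour of `τ₁`), the apex `c₂` of `τ₂ → o₂` has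
coordinate `τ₂ + 1` (anticlockwise neighbour); a cluster site before a component site would give the
interleaved quadruple `τ₁ < c < u < c₁` with a `U`-path `τ₁ ⇝ u` and a `Cl`-path `c ⇝ c₁`,
impossible in the disc `Λ_N` (`triBall_not_interleaved_shift`). [cite: BollobasRiordan2006, Ch. 7 Lemma 5 p. 169] -/
theorem annFrontier_order (hn : 1 ≤ n) (hnN : n + 2 ≤ N) (F : FrontierChains n N ω s₁ s₂) :
    (∀ u ∈ annComp n N ω s₁ s₂, ∀ c ∈ annCluster n N ω s₁, triNorm u = N → triNorm c = N →
        hexShift N F.τ₁ u < hexShift N F.τ₁ c) ∧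
      (∀ u ∈ annComp n N ω s₁ s₂, triNorm u = N → hexShift N F.τ₁ u ≤ hexShift N F.τ₁ F.τ₂) ∧
      (∀ c ∈ annCluster n N ω s₁, triNorm c = N → hexShift N F.τ₁ F.τ₂ < hexShift N F.τ₁ c) ∧
      (∀ t ∈ annComp n N ω s₁ s₂, t ∈ ω → triNorm t = N →
        0 < hexShift N F.τ₁ t ∧ hexShift N F.τ₁ t < hexShift N F.τ₁ F.τ₂) := by
  have hN : 1 ≤ N := by omega
  set U := annComp n N ω s₁ s₂ with hU
  set Cl := annCluster n N ω s₁ with hCl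
  have hτ₁U : F.τ₁ ∈ U := annFrontier_subset_annComp F.chain₁.right_mem
  have hτ₂U : F.τ₂ ∈ U := annFrontier_subset_annComp F.chain₂.left_mem
  have hτ₁c : F.τ₁ ∉ ω := (F.chain₁.right_mem).2.1
  have hτ₂c : F.τ₂ ∉ ω := (F.chain₂.left_mem).2.1
  have disj : ∀ v ∈ U, v ∉ Cl := fun v hv => (annComp_subset hv).2
  -- the clockwise neighbour `c₁`
  have hc₁N : triNorm F.c₁ = N := by
    have h1 := (mem_triAnn.1 (annCluster_subset F.c₁_mem).1).2
    have h2 := triNorm_le_triNorm_add_one_of_adj (triGraph_adj_triLeftApex_right F.adj₁).symm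
    have h3 := F.apex₁_out
    omega
  have hc₁out : triLeftApex F.τ₁ F.c₁ ∉ triBall N := by rw [mem_triBall_iff, not_le]; exact F.apex₁_out
  have hsh_c₁ : hexShift N F.τ₁ F.c₁ = 6 * N - 1 :=
    hexShift_eq_last hN F.norm_τ₁ hc₁N (hexPos_of_leftApex_out hN F.norm_τ₁ hc₁N F.adj₁ hc₁out)
  -- (i)
  have hI : ∀ u ∈ U, ∀ c ∈ Cl, triNorm u = N → triNorm c = N → hexShift N F.τ₁ u < hexShift N F.τ₁ c := by
    intro u hu c hc huN hcN
    by_contra hle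
    rw [not_lt] at hle
    have hne : hexShift N F.τ₁ c ≠ hexShift N F.τ₁ u := fun e =>
      disj u hu ((hexShift_injOn hN hcN huN e) ▸ hc)
    have hlt : hexShift N F.τ₁ c < hexShift N F.τ₁ u := lt_of_le_of_ne hle hne
    have h0 : 0 < hexShift N F.τ₁ c := by
      have hne' : hexShift N F.τ₁ c ≠ hexShift N F.τ₁ F.τ₁ := fun e =>
        disj _ hτ₁U ((hexShift_injOn hN hcN F.norm_τ₁ e) ▸ hc)
      rw [hexShift_self] at hne'
      exact lt_of_le_of_ne (hexShift_range hN F.norm_τ₁ hcN).1 hne'.symm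
    have h1 : hexShift N F.τ₁ u < hexShift N F.τ₁ F.c₁ := by
      have hne' : hexShift N F.τ₁ u ≠ hexShift N F.τ₁ F.c₁ := fun e =>
        disj u hu ((hexShift_injOn hN huN hc₁N e).symm ▸ F.c₁_mem)
      have := (hexShift_range hN F.norm_τ₁ huN).2
      rw [hsh_c₁]; omega
    refine triBall_not_interleaved_shift hN U F.norm_τ₁ F.norm_τ₁ hcN huN hc₁N
      (by rw [hexShift_self]; exact h0) hlt h1 (pathIn_ball_inter_annComp hτ₁U hu) (pathIn_ball_diff_annComp hc F.c₁_mem)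
  -- the anticlockwise neighbour `c₂ = apex (τ₂ → o₂)`
  have hc₂in : triLeftApex F.τ₂ F.o₂ ∈ triBall N :=
    mem_triBall_iff.2 (mem_triAnn.1 (annCluster_subset F.apex₂_mem).1).2
  obtain ⟨hc₂N, hc₂succ⟩ := hexPos_of_leftApex_in hN F.norm_τ₂ F.o₂_out F.adj₂ hc₂in
  have hsh_c₂ : hexShift N F.τ₁ (triLeftApex F.τ₂ F.o₂) = hexShift N F.τ₁ F.τ₂ + 1 :=
    hexShift_eq_add_one hN F.norm_τ₁ F.norm_τ₂ hc₂N hc₂succ fun e => disj _ hτ₁U (e ▸ F.apex₂_mem)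
  -- (ii)
  have hII : ∀ u ∈ U, triNorm u = N → hexShift N F.τ₁ u ≤ hexShift N F.τ₁ F.τ₂ := by
    intro u hu huN
    have := hI u hu _ F.apex₂_mem huN hc₂N
    rw [hsh_c₂] at this; omega
  refine ⟨hI, hII, fun c hc hcN => hI _ hτ₂U c hc F.norm_τ₂ hcN, fun t ht htω htN => ⟨?_, ?_⟩⟩
  · have hne : hexShift N F.τ₁ t ≠ hexShift N F.τ₁ F.τ₁ := fun e => hτ₁c ((hexShift_injOn hN htN F.norm_τ₁ e) ▸ htω)
    rw [hexShift_self] at hne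
    exact lt_of_le_of_ne (hexShift_range hN F.norm_τ₁ htN).1 hne.symm
  · have hne : hexShift N F.τ₁ t ≠ hexShift N F.τ₁ F.τ₂ := fun e => hτ₂c ((hexShift_injOn hN htN F.norm_τ₂ e) ▸ htω)
    exact lt_of_le_of_ne (hII t ht htN) hne

/-! ### The new closed arms are not joined by a closed path -/

/-- An open path from `s₂` stays in the component of `s₂` as soon as `s₂` is not in the cluster of
`s₁` (all its sites are outside the cluster, or `s₁` and `s₂` would be joined). [folklore] -/
theorem mem_annComp_of_pathIn {v : Site 2} (hsep : ¬ PathIn triGraph (triAnn n N ∩ ω) s₁ s₂)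
    (hv : PathIn triGraph (triAnn n N ∩ ω) s₂ v) : v ∈ annComp n N ω s₁ s₂ := by
  obtain ⟨S, hS, hp, htight⟩ := hv.exists_support
  refine hp.mono fun z hz => ⟨(hS hz).1, fun hzCl => hsep ?_⟩
  exact hzCl.trans ((htight z hz).mono hS).symm

/-- **The two annFrontier chains are not joined by a closed path of the annulus** (cluster form of the
family `(B₁, d₁, B₂, d₂)`): such a path `τ₁ ⇝ τ₂` of `A ∖ ω`, against the path
`t₂ ⇝ s₂ → hole ⇝ s₁ ⇝ t₁` of `(A ∖ ω)ᶜ` (open sites of `A` and the hole `Λ_{n-1}`), would be an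
interleaved pair in the disc `Λ_N`: `τ₁ < t₂ < τ₂ < t₁` by `annFrontier_order`. [cite: BollobasRiordan2006, Ch. 7 Lemma 5 p. 169] -/
theorem annFrontier_not_joined (hn : 1 ≤ n) (hnN : n + 2 ≤ N) {t₁ t₂ : Site 2}
    (hB₁ : PathIn triGraph (triAnn n N ∩ ω) s₁ t₁) (hs₁ : triNorm s₁ = n) (ht₁ : triNorm t₁ = N)
    (hB₂ : PathIn triGraph (triAnn n N ∩ ω) s₂ t₂) (hs₂ : triNorm s₂ = n) (ht₂ : triNorm t₂ = N)
    (hsep : ¬ PathIn triGraph (triAnn n N ∩ ω) s₁ s₂) (F : FrontierChains n N ω s₁ s₂) :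
    ¬ PathIn triGraph (triAnn n N \ ω) F.τ₁ F.τ₂ := by
  intro hπ
  have hN : 1 ≤ N := by omega
  obtain ⟨-, -, hIII, hIV⟩ := annFrontier_order hn hnN F
  have ht₂U : t₂ ∈ annComp n N ω s₁ s₂ := mem_annComp_of_pathIn hsep hB₂
  have ht₁Cl : t₁ ∈ annCluster n N ω s₁ := hB₁
  obtain ⟨h0, h1⟩ := hIV t₂ ht₂U hB₂.right_mem.2 ht₂
  have h2 := hIII t₁ ht₁Cl ht₁
  -- the path of `(A ∖ ω)ᶜ`: `t₂ ⇝ s₂ → hole ⇝ s₁ ⇝ t₁`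
  set B : Set (Site 2) := triAnn n N \ ω with hB
  have openB : ∀ {a b : Site 2}, PathIn triGraph (triAnn n N ∩ ω) a b →
      PathIn triGraph ((↑(triBall N) : Set (Site 2)) ∩ Bᶜ) a b := fun hp =>
    hp.mono fun z hz => ⟨Finset.mem_coe.2 (mem_triBall_iff.2 (mem_triAnn.1 hz.1).2), fun h => h.2 hz.2⟩
  have holeB : ∀ z : Site 2, triNorm z < n → z ∈ (↑(triBall N) : Set (Site 2)) ∩ Bᶜ := fun z hz =>
    ⟨Finset.mem_coe.2 (mem_triBall_iff.2 (by omega)), fun h => by have := (mem_triAnn.1 h.1).1; omega⟩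
  obtain ⟨g₁, hadj₁, hg₁⟩ := exists_adj_mem_triBall_sub_one hn hs₁
  obtain ⟨g₂, hadj₂, hg₂⟩ := exists_adj_mem_triBall_sub_one hn hs₂
  have hg₁' : triNorm g₁ < n := by have := hg₁; push_cast [Nat.cast_sub hn] at this; omega
  have hg₂' : triNorm g₂ < n := by have := hg₂; push_cast [Nat.cast_sub hn] at this; omega
  have phole : PathIn triGraph ((↑(triBall N) : Set (Site 2)) ∩ Bᶜ) g₂ g₁ :=
    (pathIn_triBall hg₂ hg₁).mono fun z hz => holeB z (by
      have := mem_triBall_iff.1 (Finset.mem_coe.1 hz); push_cast [Nat.cast_sub hn] at this; omega)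
  have hQ : PathIn triGraph ((↑(triBall N) : Set (Site 2)) ∩ Bᶜ) t₂ t₁ :=
    ((((openB hB₂).symm.tail hadj₂ (holeB g₂ hg₂')).trans phole).trans
      (PathIn.of_adj (holeB g₁ hg₁') (openB hB₁).left_mem hadj₁.symm)).trans (openB hB₁)
  have hP : PathIn triGraph ((↑(triBall N) : Set (Site 2)) ∩ B) F.τ₁ F.τ₂ :=
    hπ.mono fun z hz => ⟨Finset.mem_coe.2 (mem_triBall_iff.2 (mem_triAnn.1 hz.1).2), hz⟩
  exact triBall_not_interleaved_shift hN B F.norm_τ₁ F.norm_τ₁ ht₂ F.norm_τ₂ ht₁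
    (by rw [hexShift_self]; exact h0) h1 h2 hP hQ

/-- **Summary: two open crossings in distinct open clusters yield a certified alternating family.**
For `1 ≤ n`, `n + 2 ≤ N`, open paths `B₁ : s₁ ⇝ t₁`, `B₂ : s₂ ⇝ t₂` of the annulus
`A = {n ≤ |·| ≤ N}` from `∂Λ_n` to `∂Λ_N` not joined by an open path of `A`, there are annFrontier
chains `F` (two closed crossings `σ₁ ⇝ τ₁`, `τ₂ ⇝ σ₂` of `A`, `FrontierChains`) which are not joined
by a closed path of `A`, and around `∂Λ_N`, anticlockwise from `τ₁`: first all of the component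
of `B₂` (containing `t₂`, `τ₂` last), then all of the cluster of `B₁` (containing `t₁`):
`τ₁ < t₂ < τ₂ < t₁` — the alternating pattern `W B W B`. [cite: Nolin2008, §4.1 (arXiv 0711.4948)] [cite: BollobasRiordan2006, Ch. 7 Lemma 5 p. 169] -/
theorem exists_frontierChains_alternating (hn : 1 ≤ n) (hnN : n + 2 ≤ N) {t₁ t₂ : Site 2}
    (hB₁ : PathIn triGraph (triAnn n N ∩ ω) s₁ t₁) (hs₁ : triNorm s₁ = n) (ht₁ : triNorm t₁ = N)
    (hB₂ : PathIn triGraph (triAnn n N ∩ ω) s₂ t₂) (hs₂ : triNorm s₂ = n) (ht₂ : triNorm t₂ = N)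
    (hsep : ¬ PathIn triGraph (triAnn n N ∩ ω) s₁ s₂) :
    ∃ F : FrontierChains n N ω s₁ s₂,
      ¬ PathIn triGraph (triAnn n N \ ω) F.τ₁ F.τ₂ ∧
      0 < hexShift N F.τ₁ t₂ ∧ hexShift N F.τ₁ t₂ < hexShift N F.τ₁ F.τ₂ ∧
      hexShift N F.τ₁ F.τ₂ < hexShift N F.τ₁ t₁ := by
  have hs₂U : s₂ ∈ annComp n N ω s₁ s₂ := mem_annComp_of_pathIn hsep (PathIn.refl hB₂.left_mem)
  have ht₂U : t₂ ∈ annComp n N ω s₁ s₂ := mem_annComp_of_pathIn hsep hB₂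
  obtain ⟨F⟩ := nonempty_frontierChains hn hnN hs₁ hB₁.left_mem.2 hB₁ ht₁ hs₂U hs₂ ht₂U ht₂
  obtain ⟨-, -, hIII, hIV⟩ := annFrontier_order hn hnN F
  obtain ⟨h0, h1⟩ := hIV t₂ ht₂U hB₂.right_mem.2 ht₂
  exact ⟨F, annFrontier_not_joined hn hnN hB₁ hs₁ ht₁ hB₂ hs₂ ht₂ hsep F, h0, h1, hIII t₁ hB₁ ht₁⟩

end API

end Literature.Probability.Percolation
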